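import Literature.Analysis.FluidPDE.LerayProjector
import Literature.Analysis.FluidPDE.StatisticalSolutionEnergyEq
import Literature.Analysis.FluidPDE.NSGalerkinFourier
import HarnessLib

/-!
# Fourier coefficients of the Leray projector on the flat torus (proof)

`Literature.Analysis.FluidPDE.LerayProjector` vendors, as the named fact
`Torus.mFourierCoeff_lerayProjector`, the description of the torus Leray projector
`P = Torus.lerayProjector d` (the orthogonal projection of `L²(T^d; ℝ^d)` onto the energy space
`H = Torus.energySpace d`, the `L²` closure of the span of the smooth divergence-free mean-zero
fields `𝒱`) on the Fourier side: for every `v ∈ L²(T^d; ℝ^d)` and `k ∈ ℤ^d`,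
`(P v)^(k) = lerayCoeff k (v̂(k))`, i.e. `(P v)^(0) = 0` and
`(P v)^(k) = v̂(k) − ((k · v̂(k)) / |k|²) k` for `k ≠ 0` (Constantin–Foias 1988, Ch. 4,
(4.38)–(4.40), with `H` as in (4.33) and the bilinear pairing (4.29); Robinson–Rodrigo–
Sadowski 2016, Thm. 2.6 and Def. 2.8 with the display following it). This file **proves** it:
`Torus.mFourierCoeff_lerayProjector_holds`. (The sibling `LerayProjectorProofs.lean` discharges
the whole-space Helmholtz fact `orthogonal_solenoidalL2_eq_gradientRange` of the same file; this
one is the torus part.)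

## Proof

The sources assert the formula as the frequency-wise orthogonal decomposition
`û_k = (û_k − α_k k) + α_k k`, `α_k = (û_k · k)/|k|²` (RRS 2016, proof of Thm. 2.6). In `L²`
terms, with `P v ∈ H` and `v − P v ∈ Hᗮ` (Mathlib's `Submodule.sub_starProjection_mem_orthogonal`)
and the Fourier coefficient of an `L²` class additive (`Torus.mFourierCoeff_complexify_coe_sub`),
it is the conjunction of two inclusions, neither of which needs the density of trigonometric
polynomials:

* `H ⊆ {û(0) = 0, k · û(k) = 0}` — the Literature's
  `Torus.mFourierCoeff_complexify_coe_zero_of_mem` and `Torus.isWeaklyDivFree_of_mem_energySpace`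
  (the generators `𝒱` are mean-zero and, by integration by parts, weakly divergence free; both
  conditions are closed), followed by `Torus.IsWeaklyDivFree.sum_mul_mFourierCoeff_eq_zero`
  (RRS 2016, Ex. 2.14); hence `lerayCoeff k (û(k)) = û(k)` on `H`
  (`lerayCoeff_mFourierCoeff_of_mem_energySpace`);
* `Hᗮ ⊆ {ŵ(k) ∥ k for k ≠ 0}` — for `k ≠ 0` and a transversal `z ∈ ℂ^d` (`k · z = 0`) the
  single real mode `x ↦ Re (e_k(x) z)` (`Torus.realTrigPoly {k}`) is smooth, divergence free and
  mean zero, so it lies in `𝒱 ⊆ H`, and its `L²` pairing with `w` is `Re ⟪ŵ(k), z⟫_ℂ`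
  (`Torus.integral_inner_realTrigPoly_singleton`); with `z` and `i z` this gives
  `⟪ŵ(k), z⟫_ℂ = 0` for all transversal `z`, in particular for `z = Π_k ŵ(k)` itself, whence
  `Π_k ŵ(k) = 0` (`lerayCoeff_mFourierCoeff_of_mem_orthogonal`; CF 1988, (4.39): `P_k` is the
  projection of `ℂ^n` onto `k^⊥`).

For `k ≠ 0` the multiplier `Torus.lerayCoeff k` of `LerayProjector` coincides with the
mean-keeping multiplier `Torus.leraySym k` of `NSGalerkinFourier` (`lerayCoeff_of_ne_zero`), whose
algebra (additivity, transversality, self-adjointness against transversal vectors) is reused.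

## Imports

`StatisticalSolutionEnergyEq` / `StatisticalSolutionProofs` are imported only for their basic
facts on `H` and on Fourier coefficients of `L²` classes listed above (they are proved there and
not restated here); `NSGalerkinFourier` for `Torus.leraySym`.

## References

* P. Constantin, C. Foias, *Navier–Stokes Equations*, Univ. Chicago Press (1988), Ch. 4,
  (4.29), (4.33), (4.38)–(4.40). [ConstantinFoias1988]
* J. C. Robinson, J. L. Rodrigo, W. Sadowski, *The Three-Dimensional Navier–Stokes Equations*,
  CUP (2016), §2.1: Def. 2.1, Lemma 2.3, Thm. 2.6 (proof), Def. 2.8 and the display after it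
  (pp. 42–45). [RobinsonRodrigoSadowskiCUP2016]
-/

noncomputable section

open MeasureTheory Filter UnitAddTorus
open scoped InnerProductSpace RealInnerProductSpace ENNReal

namespace Literature.Analysis.FluidPDE

namespace Torus

variable {d : Type*} [Fintype d]

/-! ## The multiplier: `lerayCoeff k = leraySym k` for `k ≠ 0` -/

/-- Away from the zero mode the mean-zero Leray multiplier `Torus.lerayCoeff k` of
`LerayProjector` is the multiplier `Torus.leraySym k = I − k ⊗ k/|k|²` of `NSGalerkinFourier`
(both are `c ↦ c − ((k · c)/|k|²) k`; Constantin–Foias 1988, (4.39)). [folklore] -/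
theorem lerayCoeff_of_ne_zero {k : d → ℤ} (hk : k ≠ 0) (c : EuclideanSpace ℂ d) :
    lerayCoeff k c = leraySym k c := by
  rw [lerayCoeff, if_neg hk]
  rfl

/-- The torus Leray multiplier is additive in the coefficient. [folklore] -/
theorem lerayCoeff_add (k : d → ℤ) (c c' : EuclideanSpace ℂ d) :
    lerayCoeff k (c + c') = lerayCoeff k c + lerayCoeff k c' := by
  by_cases hk : k = 0
  · subst hk
    simp
  · simp only [lerayCoeff_of_ne_zero hk, leraySym_add]

/-! ## Single real modes: zero mean, `L²` pairing -/

/-- A single real Fourier mode `Re (e_k • z)` with `k ≠ 0` has zero mean on `T^d`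
(`∫ e_k = 0`, `Torus.integral_mFourier`). Local twin of the lemma of the same name in
`Barriers/NavierStokesRegularity/SharpLpLinftyNonuniquenessProofs`, which an `Analysis` file
does not import. [folklore] -/
private theorem hasZeroMean_realTrigPoly_singleton {k : d → ℤ} (hk : k ≠ 0)
    (c : (d → ℤ) → EuclideanSpace ℂ d) :
    FunctionSpaces.Torus.HasZeroMean (FunctionSpaces.Torus.realTrigPoly {k} c) := by
  unfold FunctionSpaces.Torus.HasZeroMean
  have h1 : (fun x => FunctionSpaces.Torus.realTrigPoly {k} c x) =
      fun x => FunctionSpaces.EuclideanSpace.realPart (mFourier k x • c k) :=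
    funext fun x => FunctionSpaces.Torus.realTrigPoly_singleton_apply k c x
  have hint : Integrable (fun x : UnitAddTorus d => mFourier k x • c k) volume :=
    ((mFourier k).continuous.smul continuous_const).integrable_unitAddTorus
  rw [h1, ContinuousLinearMap.integral_comp_comm _ hint, integral_smul_const,
    FunctionSpaces.Torus.integral_mFourier, if_neg hk, zero_smul, map_zero]

/-- **`L²` pairing of a class with a single real mode**: for `w ∈ L²(T^d; ℝ^d)`,
`⟪w, Re (e_k • z)⟫_{L²} = Re ⟪ŵ(k), z⟫_ℂ`, `ŵ = 𝓕(complexify ∘ w)` (Mathlib's `L2.inner_def`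
and `Torus.integral_inner_realTrigPoly_singleton`; Grafakos 2014, §3.1.1). [folklore] -/
theorem inner_toLp_realTrigPoly_singleton
    (w : Lp (EuclideanSpace ℝ d) 2 (volume : Measure (UnitAddTorus d))) (k : d → ℤ)
    (c : (d → ℤ) → EuclideanSpace ℂ d) :
    ⟪w, (FunctionSpaces.Torus.memLp_realTrigPoly {k} c 2).toLp
        (FunctionSpaces.Torus.realTrigPoly {k} c)⟫ =
      (inner ℂ (mFourierCoeff (FunctionSpaces.EuclideanSpace.complexify ∘
        (w : UnitAddTorus d → EuclideanSpace ℝ d)) k) (c k)).re := by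
  rw [MeasureTheory.L2.inner_def]
  have h : ∫ x, ⟪(w : UnitAddTorus d → EuclideanSpace ℝ d) x,
      (((FunctionSpaces.Torus.memLp_realTrigPoly {k} c 2).toLp
          (FunctionSpaces.Torus.realTrigPoly {k} c) :
            Lp (EuclideanSpace ℝ d) 2 (volume : Measure (UnitAddTorus d))) :
          UnitAddTorus d → EuclideanSpace ℝ d) x⟫ =
      ∫ x, ⟪(w : UnitAddTorus d → EuclideanSpace ℝ d) x,
        FunctionSpaces.Torus.realTrigPoly {k} c x⟫ := by
    refine integral_congr_ae ?_
    filter_upwards [(FunctionSpaces.Torus.memLp_realTrigPoly {k} c 2).coeFn_toLp] with x hx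
    rw [hx]
  rw [h]
  exact FunctionSpaces.Torus.integral_inner_realTrigPoly_singleton
    ((Lp.memLp w).integrable one_le_two) k c

variable [DecidableEq d]

/-! ## `H`: transversal mean-zero coefficients are fixed by the multiplier -/

/-- A transversal single real mode `Re (e_k • z)`, `k ≠ 0`, `k · z = 0`, lies in the energy
space `H`: it is smooth, divergence free (`Torus.isDivFree_realTrigPoly_singleton`) and mean
zero, i.e. an element of the generating set `𝒱` (Constantin–Foias 1988, Ch. 4, (4.33); these
are the Stokes eigenfields `c w_k + c̄ w_{-k}` of (4.42)).
[cite: ConstantinFoias1988, Ch. 4 (4.33)] -/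
theorem toLp_realTrigPoly_singleton_mem_energySpace {k : d → ℤ} (hk : k ≠ 0)
    {c : (d → ℤ) → EuclideanSpace ℂ d} (hc : ∑ j, (k j : ℂ) * c k j = 0) :
    (FunctionSpaces.Torus.memLp_realTrigPoly {k} c 2).toLp
        (FunctionSpaces.Torus.realTrigPoly {k} c) ∈ FunctionSpaces.Torus.energySpace d :=
  FunctionSpaces.Torus.smoothSolenoidal_subset_energySpace
    ⟨FunctionSpaces.Torus.realTrigPoly {k} c, FunctionSpaces.Torus.isSmooth_realTrigPoly _ _,
      FunctionSpaces.Torus.isDivFree_realTrigPoly_singleton hc,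
      hasZeroMean_realTrigPoly_singleton hk c, MemLp.coeFn_toLp _⟩

/-- **On `H` the multiplier is the identity on coefficients**: for `u ∈ H` and every `k`,
`lerayCoeff k (û(k)) = û(k)` — the zero mode of `u` vanishes
(`Torus.mFourierCoeff_complexify_coe_zero_of_mem`) and the other coefficients are transversal,
`k · û(k) = 0` (`Torus.isWeaklyDivFree_of_mem_energySpace` with
`Torus.IsWeaklyDivFree.sum_mul_mFourierCoeff_eq_zero`; Constantin–Foias 1988, (4.33);
Robinson–Rodrigo–Sadowski 2016, Def. 2.1 / Lemma 2.3). [cite: ConstantinFoias1988, Ch. 4 (4.33)] -/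
theorem lerayCoeff_mFourierCoeff_of_mem_energySpace
    {u : Lp (EuclideanSpace ℝ d) 2 (volume : Measure (UnitAddTorus d))}
    (hu : u ∈ FunctionSpaces.Torus.energySpace d) (k : d → ℤ) :
    lerayCoeff k (mFourierCoeff (FunctionSpaces.EuclideanSpace.complexify ∘
        (u : UnitAddTorus d → EuclideanSpace ℝ d)) k) =
      mFourierCoeff (FunctionSpaces.EuclideanSpace.complexify ∘
        (u : UnitAddTorus d → EuclideanSpace ℝ d)) k := by
  by_cases hk : k = 0
  · subst hk
    rw [lerayCoeff_zero, mFourierCoeff_complexify_coe_zero_of_mem hu]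
  · rw [lerayCoeff_of_ne_zero hk]
    exact leraySym_of_transversal
      ((isWeaklyDivFree_of_mem_energySpace hu).sum_mul_mFourierCoeff_eq_zero (Lp.memLp u) k)

/-! ## `Hᗮ`: longitudinal coefficients are killed by the multiplier -/

/-- **Coefficients of a field orthogonal to `H` are longitudinal**: if `w ∈ Hᗮ`, `k ≠ 0` and
`z ∈ ℂ^d` is transversal (`k · z = 0`), then `⟪ŵ(k), z⟫_ℂ = 0`. Indeed `Re ⟪ŵ(k), z⟫` is the
`L²` pairing of `w` with the mode `Re (e_k • z) ∈ H` (`inner_toLp_realTrigPoly_singleton`,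
`toLp_realTrigPoly_singleton_mem_energySpace`), hence zero, and the same with `i z` kills the
imaginary part (Robinson–Rodrigo–Sadowski 2016, Thm. 2.6: `Hᗮ = G`, the gradients, whose
coefficients are multiples of `k`). [cite: RobinsonRodrigoSadowskiCUP2016, Thm. 2.6 (pp. 43–44)] -/
theorem inner_mFourierCoeff_eq_zero_of_mem_orthogonal
    {w : Lp (EuclideanSpace ℝ d) 2 (volume : Measure (UnitAddTorus d))}
    (hw : w ∈ (FunctionSpaces.Torus.energySpace d)ᗮ) {k : d → ℤ} (hk : k ≠ 0)
    {z : EuclideanSpace ℂ d} (hz : ∑ j, (k j : ℂ) * z j = 0) :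
    inner ℂ (mFourierCoeff (FunctionSpaces.EuclideanSpace.complexify ∘
      (w : UnitAddTorus d → EuclideanSpace ℝ d)) k) z = 0 := by
  -- real parts against every transversal vector vanish
  have hre : ∀ z : EuclideanSpace ℂ d, ∑ j, (k j : ℂ) * z j = 0 →
      (inner ℂ (mFourierCoeff (FunctionSpaces.EuclideanSpace.complexify ∘
        (w : UnitAddTorus d → EuclideanSpace ℝ d)) k) z).re = 0 := by
    intro z hz
    rw [← inner_toLp_realTrigPoly_singleton w k (fun _ => z)]
    exact Submodule.inner_left_of_mem_orthogonal
      (toLp_realTrigPoly_singleton_mem_energySpace hk hz) hw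
  -- `i z` is transversal as well
  have hIz : ∑ j, (k j : ℂ) * (Complex.I • z) j = 0 := by
    have h : ∑ j, (k j : ℂ) * (Complex.I • z) j = Complex.I * ∑ j, (k j : ℂ) * z j := by
      rw [Finset.mul_sum]
      refine Finset.sum_congr rfl fun j _ => ?_
      rw [PiLp.smul_apply, smul_eq_mul]
      ring
    rw [h, hz, mul_zero]
  have h1 := hre z hz
  have h2 := hre _ hIz
  rw [inner_smul_right, Complex.mul_re, Complex.I_re, Complex.I_im, zero_mul, one_mul, zero_sub,
    neg_eq_zero] at h2
  apply Complex.ext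
  · simpa using h1
  · simpa using h2

/-- **On `Hᗮ` the multiplier kills the coefficients**: for `w ∈ Hᗮ` and every `k`,
`lerayCoeff k (ŵ(k)) = 0`. For `k = 0` this is the definition of `lerayCoeff`; for `k ≠ 0`,
`Π_k ŵ(k)` is transversal (`Torus.sum_mul_leraySym_apply`), so
`‖Π_k ŵ(k)‖² = ⟪ŵ(k), Π_k ŵ(k)⟫ = 0` by `Torus.inner_leraySym_left_of_transversal` and
`inner_mFourierCoeff_eq_zero_of_mem_orthogonal` (Constantin–Foias 1988, (4.39): `P_k` is the
orthogonal projection of `ℂ^n` onto `k^⊥`). [cite: ConstantinFoias1988, Ch. 4 (4.39)] -/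
theorem lerayCoeff_mFourierCoeff_of_mem_orthogonal
    {w : Lp (EuclideanSpace ℝ d) 2 (volume : Measure (UnitAddTorus d))}
    (hw : w ∈ (FunctionSpaces.Torus.energySpace d)ᗮ) (k : d → ℤ) :
    lerayCoeff k (mFourierCoeff (FunctionSpaces.EuclideanSpace.complexify ∘
      (w : UnitAddTorus d → EuclideanSpace ℝ d)) k) = 0 := by
  by_cases hk : k = 0
  · subst hk
    exact lerayCoeff_zero _
  rw [lerayCoeff_of_ne_zero hk]
  set c := mFourierCoeff (FunctionSpaces.EuclideanSpace.complexify ∘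
    (w : UnitAddTorus d → EuclideanSpace ℝ d)) k with hc
  have ht : ∑ j, (k j : ℂ) * leraySym k c j = 0 := sum_mul_leraySym_apply k c
  have h0 : inner ℂ c (leraySym k c) = 0 :=
    inner_mFourierCoeff_eq_zero_of_mem_orthogonal hw hk ht
  rw [← inner_self_eq_zero (𝕜 := ℂ), inner_leraySym_left_of_transversal k c ht, h0]

/-! ## The theorem -/

/-- **Fourier coefficients of the torus Leray projector** (discharge of the named fact
`Torus.mFourierCoeff_lerayProjector`): for `v ∈ L²(T^d; ℝ^d)` and every `k ∈ ℤ^d`,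
`(P v)^(k) = lerayCoeff k (v̂(k))`, i.e. `(P v)^(0) = 0` and
`(P v)^(k) = v̂(k) − ((k · v̂(k))/|k|²) k` for `k ≠ 0` (Constantin–Foias 1988, Ch. 4,
(4.38)–(4.40); Robinson–Rodrigo–Sadowski 2016, Def. 2.8 and the display following it). Proof:
`v = P v + (v − P v)` with `P v ∈ H`, `v − P v ∈ Hᗮ`; the coefficient map is additive on `L²`
classes (`Torus.mFourierCoeff_complexify_coe_sub`) and `lerayCoeff k` is additive, the identity
on the coefficients of `P v` (`lerayCoeff_mFourierCoeff_of_mem_energySpace`) and zero on those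
of `v − P v` (`lerayCoeff_mFourierCoeff_of_mem_orthogonal`).
[cite: ConstantinFoias1988, Ch. 4 (4.38)–(4.40)] -/
theorem mFourierCoeff_lerayProjector_holds : mFourierCoeff_lerayProjector (d := d) := by
  intro v k
  have hP : lerayProjector d v ∈ FunctionSpaces.Torus.energySpace d := lerayProjector_apply_mem v
  have hQ : v - lerayProjector d v ∈ (FunctionSpaces.Torus.energySpace d)ᗮ :=
    Submodule.sub_starProjection_mem_orthogonal v
  have hsplit : mFourierCoeff (FunctionSpaces.EuclideanSpace.complexify ∘
        (v : UnitAddTorus d → EuclideanSpace ℝ d)) k =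
      mFourierCoeff (FunctionSpaces.EuclideanSpace.complexify ∘
          ((lerayProjector d v : Lp (EuclideanSpace ℝ d) 2 (volume : Measure (UnitAddTorus d))) :
            UnitAddTorus d → EuclideanSpace ℝ d)) k +
        mFourierCoeff (FunctionSpaces.EuclideanSpace.complexify ∘
          ((v - lerayProjector d v :
              Lp (EuclideanSpace ℝ d) 2 (volume : Measure (UnitAddTorus d))) :
            UnitAddTorus d → EuclideanSpace ℝ d)) k := by
    rw [mFourierCoeff_complexify_coe_sub]
    abel
  rw [hsplit, lerayCoeff_add, lerayCoeff_mFourierCoeff_of_mem_energySpace hP,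
    lerayCoeff_mFourierCoeff_of_mem_orthogonal hQ, add_zero]

/-- Applied form of `mFourierCoeff_lerayProjector_holds`: `(P v)^(k) = lerayCoeff k (v̂(k))`
(Constantin–Foias 1988, Ch. 4, (4.38)–(4.40)). [cite: ConstantinFoias1988, Ch. 4 (4.38)–(4.40)] -/
theorem mFourierCoeff_lerayProjector_apply
    (v : Lp (EuclideanSpace ℝ d) 2 (volume : Measure (UnitAddTorus d))) (k : d → ℤ) :
    mFourierCoeff (FunctionSpaces.EuclideanSpace.complexify ∘
        ((lerayProjector d v : Lp (EuclideanSpace ℝ d) 2 (volume : Measure (UnitAddTorus d))) :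
          UnitAddTorus d → EuclideanSpace ℝ d)) k =
      lerayCoeff k (mFourierCoeff (FunctionSpaces.EuclideanSpace.complexify ∘
        (v : UnitAddTorus d → EuclideanSpace ℝ d)) k) :=
  mFourierCoeff_lerayProjector_holds v k

/-- The zero mode of a Leray projection vanishes: `(P v)^(0) = 0` (`P v ∈ H` is mean-zero;
Constantin–Foias 1988, (4.40)). [cite: ConstantinFoias1988, Ch. 4 (4.40)] -/
theorem mFourierCoeff_lerayProjector_zero
    (v : Lp (EuclideanSpace ℝ d) 2 (volume : Measure (UnitAddTorus d))) :
    mFourierCoeff (FunctionSpaces.EuclideanSpace.complexify ∘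
        ((lerayProjector d v : Lp (EuclideanSpace ℝ d) 2 (volume : Measure (UnitAddTorus d))) :
          UnitAddTorus d → EuclideanSpace ℝ d)) 0 = 0 := by
  rw [mFourierCoeff_lerayProjector_apply, lerayCoeff_zero]

/-- Away from the zero mode the Leray projection acts by the mean-keeping multiplier
`Torus.leraySym`: `(P v)^(k) = Π_k v̂(k)` for `k ≠ 0` (Constantin–Foias 1988, (4.39);
Robinson–Rodrigo–Sadowski 2016, Def. 2.8). [cite: ConstantinFoias1988, Ch. 4 (4.39)] -/
theorem mFourierCoeff_lerayProjector_of_ne_zero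
    (v : Lp (EuclideanSpace ℝ d) 2 (volume : Measure (UnitAddTorus d))) {k : d → ℤ}
    (hk : k ≠ 0) :
    mFourierCoeff (FunctionSpaces.EuclideanSpace.complexify ∘
        ((lerayProjector d v : Lp (EuclideanSpace ℝ d) 2 (volume : Measure (UnitAddTorus d))) :
          UnitAddTorus d → EuclideanSpace ℝ d)) k =
      leraySym k (mFourierCoeff (FunctionSpaces.EuclideanSpace.complexify ∘
        (v : UnitAddTorus d → EuclideanSpace ℝ d)) k) := by
  rw [mFourierCoeff_lerayProjector_apply, lerayCoeff_of_ne_zero hk]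

end Torus

end Literature.Analysis.FluidPDE
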